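import Literature.AnabelianGeometry.EtaleTheta.SettingModelChiKummerData
import Literature.AnabelianGeometry.EtaleTheta.SettingModelTateThetaOddShear
import Literature.AnabelianGeometry.EtaleTheta.ConstantMultipleRigidity
import Mathlib.Topology.Instances.ZMod
import HarnessLib

/-!
# The χ-twisted root model of [EtTh] §1 (R78), file F8: the Def. 1.7 layer `MuTwoSetting` over `modelχ`

Mochizuki, *The étale theta function and its Frobenioid-theoretic manifestations*, Publ. RIMS **45** (2009)
[EtTh], §1, Def. 1.7, PRIMS PDF p. 27 (printed 253) [cite: MochizukiEtTh2009, Def 1.7 p.27]: under "(I) `K = K̈`",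
"the Galois covering `Ẍ^log → X^log` of degree 4 determined by the multiplication by 2 map", "`X^log → C^log` …
the stack-theoretic quotient by ±1", "`Gal(Ẍ/C) ≅ (ℤ/2ℤ)³`", "`ε_μ ∈ Gal(Ẍ/X)`", "`ε_± ∈ Gal(Ẍ/C)`", "a nontrivial
element `ε_Z ∈ Gal(Ẍ/X)` which is `≠ ε_μ`". Layer L2 of the abc-iut cell, R78 cluster (χ-twisted model; integrator
abc-iut-L6-d6), hand F8 = seat abc-iut-f-113 (tranche-113 successor item: the Kummer-carrying MuTwo-level datum
that the universal closures of `Thm110i` / `Thm110iUnique` / `Thm110ii` (FACT-LIST F-0512 / F-0513 / F-0514)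
quantify over).

abc-iut-L2-t1's inhabitant `MuTwoSetting.model p` (`SettingModelMuTwo.lean`) of the Def. 1.7 interface
`MuTwoSetting` (`ConstantMultipleRigidity.lean`) lives over the DISCRETE root `ThetaSetting.model p`, where every
Kummer-indexed structure is empty (abc-iut-w5-d171, `SettingModelKummerDataEmpty`). This file transplants the same
Def. 1.7 layer to the χ-TWISTED root `ThetaSetting.modelχ p` (`SettingModelChiTheta.lean`, F5b:
`Π^tp_X := Γ ⋊_χ G_{ℚ_p}`, `Γ = F̂₂ ×_Ẑ ℤ`, `G_{ℚ_p}` Krull acting through the cyclotomic character, `K := ℚ_p`,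
`q_X := p²`, `q̈ = p`), which carries Kummer data (abc-iut-w5-d171 `kummerDataχ`, abc-iut-L2-t6 `kummerDataχSec`):

* the PARITY CHARACTER `parityχ : Π^tp_X → ℤ/2 × ℤ/2`, `g ↦ (x, y) mod 2` of the level-`2` Heisenberg shadow
  `ĥ₂(g.left)` (`levelHom 2`) — a homomorphism on the semidirect product because `χ₂(σ) = 1 ∈ (ℤ/2)^×` for every
  `σ` (abc-iut-L2-t5's `levelChar_two_eq_one`), so the twist `θ_{χ(σ)}` fixes both parities;
  **`Π^tp_Ẍ := Ker parityχ`** (`Xddχ`: index `4`, normal, contains every square and `Π^tp_Ÿ ⊆ Π^tp_{Y₂}`);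
* `Π^tp_C := Π^tp_X × ℤ/2` (`PiCprodχ`), `Π^tp_X ↪ Π^tp_C` the first factor (index `2`, normal, open), `ε_± :=` the
  generator of `ℤ/2`, `ε_μ := b` (`inl (gfpOf b)`, parity `(0,1)`), and the admissible choice `ε_Z := a`
  (`inl (gfpOf a)`, parity `(1,0)`), exactly as in the root-model file;
* RESULTS: **`MuTwoSetting.modelχ p : MuTwoSetting p`** with `modelχ_toThetaSetting : _ = ThetaSetting.modelχ p`
  (`rfl`), `MuTwoSetting.modelχ_isEtThOrigin`, `MuTwoSetting.modelχ_isAdmissibleEpsZ`,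
  `MuTwoSetting.modelχ_compat` (`ThetaSetting.compat`), and the joint-satisfiability headline
  `MuTwoSetting.exists_isEtThOrigin_and_isAdmissibleEpsZ_and_nonempty_kummerData` — **the Def. 1.7 interface, the
  origin guard, an admissible `ε_Z` AND a Kummer datum are jointly inhabited** (NV token «`MuTwoSetting` →
  WITNESSED at `modelχ`»), so the Def. 1.9 / Thm. 1.10 binders `(M : MuTwoSetting p) (E : M.EtaleThetaData)
  (S : M.StandardData E.toKummerData)` no longer range over a domain that is empty for Kummer reasons.

HONEST LIMITS: a semi-synthetic model (not the tempered fundamental group of an orbicurve; `Π^tp_C` is a direct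
product, so `ε_±` is central — the inversion variant of abc-iut-w5-d072's `SettingModelMuTwoInversion` is not
transplanted here); consistency evidence for the typed interface only. Class (b) MODEL/CONSTRUCTION file:
definitions only (new carrier `PiCprodχ` is an `abbrev` of a product, no instance declared); no `Prop` facts; nothing of [EtTh] is asserted; no side
is taken on [IUTchIII] Cor. 3.12; typed ≠ proved; instantiated ≠ endorsed.
-/

noncomputable section

namespace Literature.AnabelianGeometry.EtaleTheta.SettingModel

open Literature.AnabelianGeometry.SemiGraphs
open Function

variable (p : ℕ) [Fact p.Prime]

/-! ### Level `2`: the cyclotomic twist is trivial mod `2` -/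

/-- In `ℤ/2ℤ` every element is its own negative: `a + a = 0`. [folklore] -/
private theorem add_self_zmod_two (a : ZMod ((2 : ℕ+) : ℕ)) : a + a = 0 := by
  revert a
  decide

/-- The level-`2` twist datum of `actχ` is the identity of `Heis (ℤ/2)`: `χ₂(σ) = 1` since `(ℤ/2ℤ)^× = 1`
(abc-iut-L2-t5's `levelChar_two_eq_one`). [cite: MochizukiEtTh2009, Def 1.7 p.27] -/
theorem chiTwistData_δ_two (σ : GQp p) (h : Heis (ZMod ((2 : ℕ+) : ℕ))) : (chiTwistData p).δ 2 σ h = h := by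
  rw [chiTwistData_δ, levelChar_two_eq_one, Heis.diagTwist_apply, one_mul, one_mul]

/-- `ĥ₂(θ_{χ(σ)} γ) = ĥ₂(γ)`: the level-`2` shadow of `Γ` is `G_{ℚ_p}`-invariant. [cite: MochizukiEtTh2009, Def 1.7 p.27] -/
theorem levelHom_two_actχ (σ : GQp p) (γ : Gfp) : levelHom 2 (actχ p σ γ) = levelHom 2 γ := by
  rw [(chiTwistData p).hlev 2 σ γ, chiTwistData_δ_two]

/-! ### The parity character and `Δ^tp_Ẍ ≤ Γ` -/

/-- The `(x, y) mod 2` character of `Γ`: `a`- and `b`-exponent parities of the level-`2` Heisenberg shadow.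
[cite: MochizukiEtTh2009, Def 1.7 p.27] -/
def xyTwo : Gfp →* Multiplicative (ZMod ((2 : ℕ+) : ℕ)) × Multiplicative (ZMod ((2 : ℕ+) : ℕ)) :=
  (Heis.xHom.prod Heis.yHom).comp (levelHom 2)

/-- [cite: MochizukiEtTh2009, Def 1.7 p.27] -/
theorem xyTwo_apply (γ : Gfp) :
    xyTwo γ = (Multiplicative.ofAdd (levelHom 2 γ).x, Multiplicative.ofAdd (levelHom 2 γ).y) := rfl

/-- `xyTwo` is `G_{ℚ_p}`-invariant. [cite: MochizukiEtTh2009, Def 1.7 p.27] -/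
theorem xyTwo_actχ (σ : GQp p) (γ : Gfp) : xyTwo (actχ p σ γ) = xyTwo γ := by
  rw [xyTwo_apply, xyTwo_apply, levelHom_two_actχ]

/-- On the graph elements: `xyTwo (gfpOf g) = (x(g), y(g)) mod 2`. [cite: MochizukiEtTh2009, Def 1.7 p.27] -/
theorem xyTwo_gfpOf (g : F₂) :
    xyTwo (gfpOf g) = (Multiplicative.ofAdd (((heisHom g).x : ℤ) : ZMod ((2 : ℕ+) : ℕ)),
      Multiplicative.ofAdd (((heisHom g).y : ℤ) : ZMod ((2 : ℕ+) : ℕ))) := by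
  rw [xyTwo_apply, levelHom_gfpOf, Heis.map_apply]
  rfl

/-- `xyTwo` is surjective (the loops `a`, `b` give the two generators). [cite: MochizukiEtTh2009, Def 1.7 p.27] -/
theorem xyTwo_surjective : Surjective xyTwo := by
  intro t
  obtain ⟨x, hx⟩ := ZMod.intCast_surjective (Multiplicative.toAdd t.1)
  obtain ⟨y, hy⟩ := ZMod.intCast_surjective (Multiplicative.toAdd t.2)
  refine ⟨gfpOf ((FreeGroup.of 0) ^ x * (FreeGroup.of 1) ^ y), ?_⟩
  rw [xyTwo_gfpOf, map_mul, map_zpow, map_zpow, heisHom_of_zero, heisHom_of_one]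
  have h0 : ∀ n : ℤ, ((⟨1, 0, 0⟩ : Heis ℤ) ^ n) = ⟨n, 0, 0⟩ := by
    intro n
    induction n using Int.induction_on with
    | zero => ext <;> simp
    | succ n ih => rw [zpow_add_one, ih]; ext <;> simp
    | pred n ih => rw [zpow_sub_one, ih]; ext <;> simp; ring
  have h1 : ∀ n : ℤ, ((⟨0, 1, 0⟩ : Heis ℤ) ^ n) = ⟨0, n, 0⟩ := by
    intro n
    induction n using Int.induction_on with
    | zero => ext <;> simp
    | succ n ih => rw [zpow_add_one, ih]; ext <;> simp
    | pred n ih => rw [zpow_sub_one, ih]; ext <;> simp; ring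
  rw [h0, h1]
  have hx' : ((x : ℤ) : ZMod ((2 : ℕ+) : ℕ)) = Multiplicative.toAdd t.1 := hx
  have hy' : ((y : ℤ) : ZMod ((2 : ℕ+) : ℕ)) = Multiplicative.toAdd t.2 := hy
  refine Prod.ext ?_ ?_
  · show Multiplicative.ofAdd (((x + 0 : ℤ)) : ZMod ((2 : ℕ+) : ℕ)) = t.1
    rw [add_zero, hx', ofAdd_toAdd]
  · show Multiplicative.ofAdd (((0 + y : ℤ)) : ZMod ((2 : ℕ+) : ℕ)) = t.2
    rw [zero_add, hy', ofAdd_toAdd]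

/-- `Δ^tp_Ẍ := Ker xyTwo ≤ Γ`: even `a`- and `b`-exponent — the subgroup of "the Galois covering `Ẍ^log → X^log` of
degree 4 determined by the multiplication by 2 map". [cite: MochizukiEtTh2009, Def 1.7 p.27] -/
def dXdd : Subgroup Gfp := xyTwo.ker

/-- [cite: MochizukiEtTh2009, Def 1.7 p.27] -/
theorem mem_dXdd_iff (γ : Gfp) : γ ∈ dXdd ↔ (levelHom 2 γ).x = 0 ∧ (levelHom 2 γ).y = 0 := by
  rw [dXdd, MonoidHom.mem_ker, xyTwo_apply, Prod.mk_eq_one]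
  exact Iff.rfl

/-- `Δ^tp_{Y₂} ≤ Δ^tp_Ẍ` (degree `0`, `2 ∣ y`). [cite: MochizukiEtTh2009, Def 1.7 p.27] -/
theorem dY_two_le_dXdd : dY 2 ≤ dXdd := fun γ hγ =>
  (mem_dXdd_iff γ).mpr (Subgroup.mem_comap.mp (Subgroup.mem_inf.mp hγ).2)

/-- `[Γ : Δ^tp_Ẍ] = 4`. [cite: MochizukiEtTh2009, Def 1.7 p.27] -/
theorem index_dXdd : dXdd.index = 4 := by
  rw [dXdd, Subgroup.index_ker, MonoidHom.range_eq_top.mpr xyTwo_surjective, Subgroup.card_top]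
  show Nat.card (ZMod 2 × ZMod 2) = 4
  rw [Nat.card_prod, Nat.card_zmod]

/-! ### `Π^tp_Ẍ ≤ Π^tp_X = Γ ⋊_χ G_{ℚ_p}` -/

/-- **The parity character of `Π^tp_X`**: `g ↦ xyTwo(g.left)` — a homomorphism since the twist fixes `xyTwo`.
[cite: MochizukiEtTh2009, Def 1.7 p.27] -/
def parityχ : PiTpχ p →* Multiplicative (ZMod ((2 : ℕ+) : ℕ)) × Multiplicative (ZMod ((2 : ℕ+) : ℕ)) :=
  Semidirect.leftHom xyTwo (xyTwo_actχ p)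

/-- [cite: MochizukiEtTh2009, Def 1.7 p.27] -/
theorem parityχ_apply (g : PiTpχ p) : parityχ p g = xyTwo g.left := rfl

/-- [cite: MochizukiEtTh2009, Def 1.7 p.27] -/
theorem parityχ_inl (γ : Gfp) : parityχ p (SemidirectProduct.inl γ) = xyTwo γ := by
  rw [parityχ_apply, SemidirectProduct.left_inl]

/-- `parityχ` is surjective. [cite: MochizukiEtTh2009, Def 1.7 p.27] -/
theorem parityχ_surjective : Surjective (parityχ p) :=
  Semidirect.leftHom_surjective xyTwo (xyTwo_actχ p) xyTwo_surjective

/-- **`Π^tp_Ẍ := Ker parityχ = Δ^tp_Ẍ ⋊ G_{ℚ_p} ≤ Π^tp_X`** ("`Ẍ^log → X^log` … of degree 4"; `K = K̈ = ℚ_p` at the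
model, so no base change). [cite: MochizukiEtTh2009, Def 1.7 p.27] -/
def Xddχ : Subgroup (PiTpχ p) := (parityχ p).ker

/-- [cite: MochizukiEtTh2009, Def 1.7 p.27] -/
theorem mem_Xddχ_iff (g : PiTpχ p) : g ∈ Xddχ p ↔ g.left ∈ dXdd := by
  rw [Xddχ, MonoidHom.mem_ker, dXdd, MonoidHom.mem_ker, parityχ_apply]

/-- `Π^tp_Ẍ` is normal in `Π^tp_X`. [cite: MochizukiEtTh2009, Def 1.7 p.27] -/
theorem Xddχ_normal : (Xddχ p).Normal := inferInstanceAs (parityχ p).ker.Normal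

/-- `[Π^tp_X : Π^tp_Ẍ] = 4`. [cite: MochizukiEtTh2009, Def 1.7 p.27] -/
theorem index_Xddχ : (Xddχ p).index = 4 := by
  rw [Xddχ, Subgroup.index_ker, MonoidHom.range_eq_top.mpr (parityχ_surjective p), Subgroup.card_top]
  show Nat.card (ZMod 2 × ZMod 2) = 4
  rw [Nat.card_prod, Nat.card_zmod]

/-- Every square of `Π^tp_X` lies in `Π^tp_Ẍ` (`Π^tp_X/Π^tp_Ẍ ≅ (ℤ/2)²`). [cite: MochizukiEtTh2009, Def 1.7 p.27] -/
theorem mul_self_mem_Xddχ (g : PiTpχ p) : g * g ∈ Xddχ p := by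
  rw [Xddχ, MonoidHom.mem_ker, map_mul, parityχ_apply, xyTwo_apply, Prod.mk_mul_mk, Prod.mk_eq_one,
    ← ofAdd_add, ← ofAdd_add, add_self_zmod_two, add_self_zmod_two]
  exact ⟨rfl, rfl⟩

/-- `Π^tp_Ÿ ≤ Π^tp_Ẍ` at the χ-model (`Π^tp_Ÿ ⊆ Π^tp_{Y₂} = Δ^tp_{Y₂} ⋊ G_{K₂}`). [cite: MochizukiEtTh2009, Def 1.7 p.27] -/
theorem gtpYdd_modelχ_le_Xddχ : (ThetaSetting.modelχ p).GtpYdd ≤ Xddχ p := by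
  intro x hx
  have h1 : x ∈ YNχ p (2 * 1) := hx.1
  have h2 : x.left ∈ dY (2 * 1) := ((chiTwistData p).mem_YN.mp h1).1
  have h3 : (2 * 1 : ℕ+) = 2 := rfl
  rw [h3] at h2
  exact (mem_Xddχ_iff p x).mpr (dY_two_le_dXdd h2)

/-- `a ∉ Π^tp_Ẍ` (parity `(1, 0)`). [cite: MochizukiEtTh2009, Def 1.7 p.27] -/
theorem inl_gfpOf_zero_not_mem_Xddχ : (SemidirectProduct.inl (gfpOf (FreeGroup.of 0)) : PiTpχ p) ∉ Xddχ p := by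
  rw [Xddχ, MonoidHom.mem_ker, parityχ_inl, xyTwo_gfpOf, heisHom_of_zero, Prod.mk_eq_one]
  rintro ⟨h, -⟩
  revert h
  decide

/-- `b ∉ Π^tp_Ẍ` (parity `(0, 1)`). [cite: MochizukiEtTh2009, Def 1.7 p.27] -/
theorem inl_gfpOf_one_not_mem_Xddχ : (SemidirectProduct.inl (gfpOf (FreeGroup.of 1)) : PiTpχ p) ∉ Xddχ p := by
  rw [Xddχ, MonoidHom.mem_ker, parityχ_inl, xyTwo_gfpOf, heisHom_of_one, Prod.mk_eq_one]
  rintro ⟨-, h⟩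
  revert h
  decide

/-- `a · b⁻¹ ∉ Π^tp_Ẍ` (parity `(1, 1)`; so `ε_Z := a` is `≠ ε_μ := b` in `Gal(Ẍ/X)`). [cite: MochizukiEtTh2009, Def 1.7 p.27] -/
theorem inl_gfpOf_zero_mul_inv_not_mem_Xddχ :
    (SemidirectProduct.inl (gfpOf (FreeGroup.of 0)) : PiTpχ p) *
        (SemidirectProduct.inl (gfpOf (FreeGroup.of 1)))⁻¹ ∉ Xddχ p := by
  rw [Xddχ, MonoidHom.mem_ker, map_mul, map_inv, parityχ_inl, parityχ_inl, xyTwo_gfpOf, xyTwo_gfpOf,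
    heisHom_of_zero, heisHom_of_one, Prod.inv_mk, Prod.mk_mul_mk, Prod.mk_eq_one]
  rintro ⟨h, -⟩
  revert h
  decide

/-! ### `Π^tp_C := Π^tp_X × ℤ/2` -/

/-- **`Π^tp_C := Π^tp_X × ℤ/2`** over the χ-model — the model of the tempered fundamental group of the orbicurve
`C = X/±1` (with `ε_±` central). [cite: MochizukiEtTh2009, Def 1.7 p.27] -/
abbrev PiCprodχ : Type := PiTpχ p × Multiplicative (ZMod 2)

/-- `Π^tp_X ↪ Π^tp_C`, the first factor. [cite: MochizukiEtTh2009, Def 1.7 p.27] -/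
def inclXχ : PiTpχ p →* PiCprodχ p := MonoidHom.inl (PiTpχ p) (Multiplicative (ZMod 2))

/-- [cite: MochizukiEtTh2009, Def 1.7 p.27] -/
theorem inclXχ_apply (x : PiTpχ p) : inclXχ p x = (x, 1) := rfl

/-- `Π^tp_X ↪ Π^tp_C` is continuous. [cite: MochizukiEtTh2009, Def 1.7 p.27] -/
theorem continuous_inclXχ : Continuous (inclXχ p) :=
  continuous_id.prodMk continuous_const

/-- The image of `Π^tp_X` in `Π^tp_C` is `Π^tp_X × 1`. [cite: MochizukiEtTh2009, Def 1.7 p.27] -/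
theorem range_inclXχ : (inclXχ p).range = (⊤ : Subgroup (PiTpχ p)).prod ⊥ := by
  ext x
  constructor
  · rintro ⟨y, rfl⟩
    exact ⟨trivial, (Subgroup.mem_bot).mpr rfl⟩
  · rintro ⟨-, hx⟩
    exact ⟨x.1, Prod.ext rfl ((Subgroup.mem_bot.mp hx).symm)⟩

/-- `A ↦ A × 1` under `inclX`. [cite: MochizukiEtTh2009, Def 1.7 p.27] -/
theorem map_inclXχ (A : Subgroup (PiTpχ p)) : A.map (inclXχ p) = A.prod ⊥ := by
  ext x
  constructor
  · rintro ⟨y, hy, rfl⟩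
    exact ⟨hy, (Subgroup.mem_bot).mpr rfl⟩
  · rintro ⟨hx1, hx2⟩
    exact ⟨x.1, hx1, Prod.ext rfl ((Subgroup.mem_bot.mp hx2).symm)⟩

/-- The image of `Π^tp_X` is open in `Π^tp_C` (`ℤ/2` is discrete). [cite: MochizukiEtTh2009, Def 1.7 p.27] -/
theorem isOpen_range_inclXχ : IsOpen ((inclXχ p).range : Set (PiCprodχ p)) := by
  rw [range_inclXχ, Subgroup.coe_prod]
  exact isOpen_univ.prod (isOpen_discrete _)

/-! ### The inhabitant of `MuTwoSetting p` over `modelχ` -/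

/-- **The Def. 1.7 layer over the χ-twisted model.** An explicit inhabitant of `MuTwoSetting p` extending
`ThetaSetting.modelχ p`: (I) `q̈ = p ∈ K = ℚ_p`; `Π^tp_C := Π^tp_X × ℤ/2`; `Π^tp_Ẍ := Ker parityχ` (even `a`- and
`b`-parity); `ε_μ := b`; `ε_± :=` the generator of `ℤ/2`. Consistency evidence only. [cite: MochizukiEtTh2009, Def 1.7 p.27] -/
abbrev _root_.Literature.AnabelianGeometry.EtaleTheta.MuTwoSetting.modelχ : MuTwoSetting p where
  toThetaSetting := ThetaSetting.modelχ p
  sqrtqX_mem_K := natCast_mem _ p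
  GtpC := PiCprodχ p
  inclX := inclXχ p
  continuous_inclX := continuous_inclXχ p
  injective_inclX := fun a b h => congrArg Prod.fst h
  isOpen_range_inclX := isOpen_range_inclXχ p
  range_inclX_normal := by rw [range_inclXχ]; infer_instance
  index_range_inclX := by
    rw [range_inclXχ, Subgroup.index_prod, Subgroup.index_top, Subgroup.index_bot, one_mul]
    show Nat.card (ZMod 2) = 2
    exact Nat.card_zmod 2
  GtpXdd := Xddχ p
  index_GtpXdd := index_Xddχ p
  map_GtpXdd_normal := by
    rw [map_inclXχ]
    haveI := Xddχ_normal p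
    infer_instance
  sq_mem_GtpXdd g := by
    rw [map_inclXχ, Subgroup.mem_prod, Subgroup.mem_bot]
    refine ⟨mul_self_mem_Xddχ p g.1, ?_⟩
    show g.2 * g.2 = 1
    have h2 : ∀ t : Multiplicative (ZMod 2), t * t = 1 := by decide
    exact h2 g.2
  GtpYdd_le_GtpXdd := gtpYdd_modelχ_le_Xddχ p
  epsMu := inclXχ p (SemidirectProduct.inl (gfpOf (FreeGroup.of 1)))
  epsMu_mem := ⟨_, rfl⟩
  epsMu_not_mem := by
    rw [map_inclXχ]
    rintro ⟨h1, -⟩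
    exact inl_gfpOf_one_not_mem_Xddχ p h1
  epsPM := (1, Multiplicative.ofAdd 1)
  epsPM_not_mem := by
    rintro ⟨y, hy⟩
    have h2 : ((inclXχ p) y).2 = Multiplicative.ofAdd 1 := congrArg Prod.snd hy
    have h1 : ((inclXχ p) y).2 = 1 := rfl
    rw [h1] at h2
    exact absurd h2 (by decide)

/-- The Def. 1.7 layer sits over the χ-twisted root. [cite: MochizukiEtTh2009, Def 1.7 p.27] -/
theorem _root_.Literature.AnabelianGeometry.EtaleTheta.MuTwoSetting.modelχ_toThetaSetting :
    (MuTwoSetting.modelχ p).toThetaSetting = ThetaSetting.modelχ p := rfl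

/-- … hence satisfies the guard `IsEtThOrigin` (`Δ_X = F̂₂` free profinite on two generators).
[cite: MochizukiEtTh2009, §1 p.12] -/
theorem _root_.Literature.AnabelianGeometry.EtaleTheta.MuTwoSetting.modelχ_isEtThOrigin :
    (MuTwoSetting.modelχ p).toThetaSetting.IsEtThOrigin :=
  ThetaSetting.modelχ_isEtThOrigin p

/-- … and the §1 containments `Compat` (which hold for every theta setting, abc-iut-L2-t1
`ThetaSetting.compat`). [cite: MochizukiEtTh2009, Prop 1.5 p.22] -/
theorem _root_.Literature.AnabelianGeometry.EtaleTheta.MuTwoSetting.modelχ_compat :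
    (MuTwoSetting.modelχ p).toThetaSetting.Compat :=
  (ThetaSetting.modelχ p).compat

/-- The admissible choice `ε_Z := a` of the model (as an element of `Π^tp_C`). [cite: MochizukiEtTh2009, Def 1.7 p.27] -/
def epsZχ : PiCprodχ p := inclXχ p (SemidirectProduct.inl (gfpOf (FreeGroup.of 0)))

/-- **`ε_Z := a` is an admissible choice** at the χ-model (Def. 1.7: "a nontrivial element `ε_Z ∈ Gal(Ẍ/X)`
which is `≠ ε_μ`"): so the curves `Ẋ`, `Ċ` of type `(1, μ₂)`, `(1, μ₂)±` exist over the χ-model.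
[cite: MochizukiEtTh2009, Def 1.7 p.27] -/
theorem _root_.Literature.AnabelianGeometry.EtaleTheta.MuTwoSetting.modelχ_isAdmissibleEpsZ :
    (MuTwoSetting.modelχ p).IsAdmissibleEpsZ (epsZχ p) := by
  refine ⟨⟨_, rfl⟩, ?_, ?_⟩
  · show epsZχ p ∉ (Xddχ p).map (inclXχ p)
    rw [map_inclXχ]
    rintro ⟨h1, -⟩
    exact inl_gfpOf_zero_not_mem_Xddχ p h1
  · show epsZχ p * (inclXχ p (SemidirectProduct.inl (gfpOf (FreeGroup.of 1))))⁻¹ ∉ (Xddχ p).map (inclXχ p)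
    rw [epsZχ, map_inclXχ, ← map_inv, ← map_mul]
    rintro ⟨h1, -⟩
    exact inl_gfpOf_zero_mul_inv_not_mem_Xddχ p h1

/-- `toZ(ε_Z) = 1 ∈ ℤ` (the degree of `a`): the admissible `ε_Z := a` of the model has ODD degree, so
`Π^tp_Ẋ ∩ Π^tp_X = Π^tp_Ÿ · ⟨a⟩` (used by the orbit computation of the Thm. 1.10 tests).
[cite: MochizukiEtTh2009, Def 1.9 p.29] -/
theorem toZ_inl_gfpOf_zero :
    (ThetaSetting.modelχ p).toZ (SemidirectProduct.inl (gfpOf (FreeGroup.of 0))) = Multiplicative.ofAdd 1 := by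
  show gfpSnd (SemidirectProduct.inl (gfpOf (FreeGroup.of 0)) : PiTpχ p).left = _
  rw [SemidirectProduct.left_inl]
  rfl

/-- **Joint satisfiability at a Kummer-carrying model**: there is a `MuTwoSetting p` whose theta setting
satisfies the guard `IsEtThOrigin` and `Compat`, which admits an admissible `ε_Z`, AND which carries Kummer data
(abc-iut-w5-d171's `nonempty_kummerData_modelχ`) — every Def. 1.7 / 1.9 / Thm. 1.10 statement of
`ConstantMultipleRigidity.lean` quantifies over a domain inhabited at the Kummer level.
[cite: MochizukiEtTh2009, Def 1.7 p.27] -/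
theorem _root_.Literature.AnabelianGeometry.EtaleTheta.MuTwoSetting.exists_isEtThOrigin_and_isAdmissibleEpsZ_and_nonempty_kummerData :
    ∃ M : MuTwoSetting p, M.toThetaSetting.IsEtThOrigin ∧ M.toThetaSetting.Compat ∧
      (∃ εZ : M.GtpC, M.IsAdmissibleEpsZ εZ) ∧ Nonempty M.toThetaSetting.KummerData :=
  ⟨MuTwoSetting.modelχ p, MuTwoSetting.modelχ_isEtThOrigin p, MuTwoSetting.modelχ_compat p,
    ⟨_, MuTwoSetting.modelχ_isAdmissibleEpsZ p⟩, nonempty_kummerData_modelχ p⟩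

end Literature.AnabelianGeometry.EtaleTheta.SettingModel

end
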